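import Mathlib

/-!
# The universal phase-grating profile `τ*(A;s)`: algebraic core of the van der Corput majorant (K22)

Solo seat `solo-AtomisticToContinuum-blind`, conjunct `BoseEinsteinCondensation`; paper §11.7
(No-go F″-φ) and `work/tau_majorant/tau_majorant.md`.  For the unimodular grating
`T(θ) = e^{iA R(θ;s)}`, `R(θ;s) = |1 + s e^{iθ}| = √(1 + s² + 2s cos θ)`, the profile
`τ(A;s) = sup_m |T̂(m)|²` obeys `τ(A;s) ≤ min{1, 12·(A·min(s,1))^{-2/3}}`.  The proof is a
one-dimensional van der Corput argument for the phase `Φ = A R − mθ` on a half period, whose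
second derivative is monotone; everything problem-specific in it is the algebra of the radial
function, which this file checks (`0 ≤ s < 1`, `c = cos θ`, `σ² = 1 − c²`, `B = As`,
`N = (s + c)(1 + sc)`, so that `R′ = −sσ/R`, `R″ = −sN/R³`, `R‴ = sσ(R⁴ − 3sN)/R⁵`):

1. `hasDerivAt_radial`, `radial_secondDeriv_numerator`, `radial_inflexion_deriv`,
   `radial_fourth_sub_eq` / `_nonneg` / `_pos` — the derivative identities and
   `R⁴ − 3sN = (sc + (1+s²)/2)² + ¾(1 − s²)² ≥ 0` (so `Φ‴ ≥ 0` on `[0,π]`: `Φ″` is monotone,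
   vanishing only at the inflexion point `c = −s`, `inflexion_unique`).
2. `moebius_*` — in the variable `x = (c + s)/(1 + sc)`, i.e. `c(1 − sx) = x − s`:
   `N = (1−s²)²x/(1−sx)²`, `R² = (1−s²)(1+sx)/(1−sx)`, `σ² = (1−s²)(1−x²)/(1−sx)²`,
   `R⁴ − 3sN = (1−s²)²(1−sx+s²x²)/(1−sx)²`, and the normalised profiles
   (M1) `f₂² = N²/R⁶ = (1−s²)x²/((1−sx)(1+sx)³)`,
   (M2) `f₃² = σ²(R⁴−3sN)²/R¹⁰ = (1−x²)(1−sx+s²x²)²/((1−sx)(1+sx)⁵)`,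
   (M3) `(σ/R)² = (1−x²)/((1−sx)(1+sx))`.
3. Lemma (A) `4f₂² + 16f₃² ≥ 1`: `profile_poly_hom_nonneg` / `profile_poly_nonneg` (the polynomial
   `P(u,y) = 4(u−y²)(1+y)² + 16(1−u)(1−y+y²)² − (1−y)(1+y)⁵ ≥ 0` on `y² ≤ u ≤ 1`, affine in `u`,
   with `P(1,y) = (1−y)²(1+y)³(3+y)`, `P(y²,y) = 3(1−y)³(1+y)(5y²−2y+5)`) and the DIRECT form
   `four_normSecond_sq_add_sixteen_normThird_sq`: `R¹⁰ ≤ 4N²R⁴ + 16σ²(R⁴−3sN)²`.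
4. Lemma (B) `(σ/R)² + 4f₂² ≥ 1`: `sinRatio_sq_add_four_normSecond_sq` via
   `σ²R⁴ + 4N² − R⁶ = (s+c)²(1−s²)(3 + 4sc + s²)`.
5. The thresholds (A′) `f₂ < 0.33 ⟹ f₃ > 0.18781`, (B′) `σ/R < 3/4 ⟹ f₂ > √7/8` and the
   numerical bookkeeping behind the final constant `12` (`const_case_*`).

Only Mathlib is used; no definitions are introduced.
-/

noncomputable section

open scoped Real

namespace Summit.AtomisticToContinuum.BoseEinsteinCondensation.Theorems

/-! ## 1. Derivatives of the radial function `R(θ;s) = √(1 + s² + 2s cos θ)` -/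

/-- `R² = 1 + s² + 2sc > 0` and `1 + sc > 0` for `0 ≤ s < 1`, `c ≥ −1`. -/
theorem radialSq_pos (s c : ℝ) (hs0 : 0 ≤ s) (hs1 : s < 1) (hc : -1 ≤ c) :
    0 < 1 + s ^ 2 + 2 * s * c ∧ 0 < 1 + s * c := by
  have := mul_nonneg hs0 (show 0 ≤ c + 1 by linarith)
  constructor <;> nlinarith

/-- The first derivative: `d/dθ √(1 + s² + 2s cos θ) = −s sin θ / √(1 + s² + 2s cos θ)`. -/
theorem hasDerivAt_radial (s θ : ℝ) (hg : 0 < 1 + s ^ 2 + 2 * s * Real.cos θ) :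
    HasDerivAt (fun θ => Real.sqrt (1 + s ^ 2 + 2 * s * Real.cos θ))
      (-(s * Real.sin θ) / Real.sqrt (1 + s ^ 2 + 2 * s * Real.cos θ)) θ := by
  have h1 : HasDerivAt (fun θ => 1 + s ^ 2 + 2 * s * Real.cos θ) (2 * s * -Real.sin θ) θ :=
    ((Real.hasDerivAt_cos θ).const_mul (2 * s)).const_add (1 + s ^ 2)
  have hsq : Real.sqrt (1 + s ^ 2 + 2 * s * Real.cos θ) ≠ 0 := (Real.sqrt_pos.2 hg).ne'
  convert h1.sqrt (ne_of_gt hg) using 1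
  field_simp

/-- Numerator of `R″`: differentiating `R′ = −sσ/R` gives `R″ = −s(cR² + sσ²)/R³`, and
`cR² + sσ² = (s + c)(1 + sc) = N`. -/
theorem radial_secondDeriv_numerator (s c : ℝ) :
    c * (1 + s ^ 2 + 2 * s * c) + s * (1 - c ^ 2) = (s + c) * (1 + s * c) := by
  ring

/-- `dN/dc = (1 + sc) + s(s + c) = R²`, i.e. `dN/dθ = −σR²`; hence
`R‴ = −s(N′R³ − 3NR²R′)/R⁶ = sσ(R⁴ − 3sN)/R⁵` (second conjunct, multiplied through by `R`). -/
theorem radial_inflexion_deriv (s c σ R2 N : ℝ) :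
    (1 + s * c) + s * (s + c) = 1 + s ^ 2 + 2 * s * c ∧
    -s * ((-σ * R2) * R2 ^ 2 - 3 * N * R2 * (-s * σ)) = s * σ * R2 * (R2 ^ 2 - 3 * s * N) := by
  constructor <;> ring

/-- `R⁴ − 3sN = (sc + (1 + s²)/2)² + ¾(1 − s²)²`; in the variables `p = 1 + sc`, `q = s + c`
(`N = pq`, `R² = p + sq`, `p − sq = 1 − s²`, `p² − q² = (1−s²)σ²`) it is `p² − spq + s²q²`. -/
theorem radial_fourth_sub_eq (s c : ℝ) :
    (1 + s ^ 2 + 2 * s * c) ^ 2 - 3 * s * ((s + c) * (1 + s * c))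
      = (s * c + (1 + s ^ 2) / 2) ^ 2 + 3 / 4 * (1 - s ^ 2) ^ 2 ∧
    (1 + s ^ 2 + 2 * s * c) ^ 2 - 3 * s * ((s + c) * (1 + s * c))
      = (1 + s * c) ^ 2 - s * (1 + s * c) * (s + c) + s ^ 2 * (s + c) ^ 2 ∧
    (1 + s * c) ^ 2 - (s + c) ^ 2 = (1 - s ^ 2) * (1 - c ^ 2) := by
  refine ⟨by ring, by ring, by ring⟩

/-- Hence `R⁴ − 3sN ≥ 0` for all real `s, c`: `Φ‴ = Bσ(R⁴−3sN)/R⁵ ≥ 0` on `[0,π]`, -/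
theorem radial_fourth_sub_nonneg (s c : ℝ) :
    0 ≤ (1 + s ^ 2 + 2 * s * c) ^ 2 - 3 * s * ((s + c) * (1 + s * c)) := by
  rw [(radial_fourth_sub_eq s c).1]; positivity

/-- and `R⁴ − 3sN > 0` as soon as `s² < 1`. -/
theorem radial_fourth_sub_pos (s c : ℝ) (hs : s ^ 2 < 1) :
    0 < (1 + s ^ 2 + 2 * s * c) ^ 2 - 3 * s * ((s + c) * (1 + s * c)) := by
  rw [(radial_fourth_sub_eq s c).1]
  have h : 0 < (1 - s ^ 2) ^ 2 := by
    have : 0 < 1 - s ^ 2 := by linarith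
    positivity
  nlinarith [sq_nonneg (s * c + (1 + s ^ 2) / 2)]

/-- `N = (s+c)(1+sc)` vanishes on `c ≥ −1` only at `c = −s` (the inflexion point `θ* = arccos(−s)`,
where `R² = σ² = 1 − s²`, `f₂ = 0`, `σ/R = 1`, `f₃ = 1`: the Airy point `Φ‴(θ*) = B`). -/
theorem inflexion_unique (s c : ℝ) (hs0 : 0 ≤ s) (hs1 : s < 1) (hc : -1 ≤ c) :
    (s + c) * (1 + s * c) = 0 ↔ c = -s := by
  have hp := (radialSq_pos s c hs0 hs1 hc).2
  constructor
  · intro hN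
    rcases mul_eq_zero.1 hN with h | h
    · linarith
    · exact absurd h hp.ne'
  · rintro rfl; ring

/-! ## 2. The Möbius variable `x = (c + s)/(1 + sc)`, i.e. `c(1 − sx) = x − s` -/

/-- `x(1 + sc) = c + s ⟺ c(1 − sx) = x − s`; and `|x| ≤ 1` for `|c| ≤ 1`, `0 ≤ s < 1`. -/
theorem moebius_inverse (s x c : ℝ) : c * (1 - s * x) = x - s ↔ x * (1 + s * c) = c + s := by
  constructor <;> intro h <;> linarith [h]

/-- `x = (c + s)/(1 + sc) ∈ [−1,1]` for `|c| ≤ 1`, `0 ≤ s < 1`. -/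
theorem moebius_mem_Icc (s c : ℝ) (hs0 : 0 ≤ s) (hs1 : s < 1) (hc1 : -1 ≤ c) (hc2 : c ≤ 1) :
    -1 ≤ (c + s) / (1 + s * c) ∧ (c + s) / (1 + s * c) ≤ 1 := by
  have hp := (radialSq_pos s c hs0 hs1 hc1).2
  constructor
  · rw [le_div_iff₀ hp]; nlinarith [mul_nonneg hs0 (show 0 ≤ c + 1 by linarith)]
  · rw [div_le_iff₀ hp]; nlinarith [mul_nonneg hs0 (show 0 ≤ 1 - c by linarith)]

/-- `p = 1 + sc = (1−s²)/(1−sx)` and `q = s + c = (1−s²)x/(1−sx)` (cleared of denominators). -/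
theorem moebius_pq (s x c : ℝ) (hc : c * (1 - s * x) = x - s) :
    (1 + s * c) * (1 - s * x) = 1 - s ^ 2 ∧ (s + c) * (1 - s * x) = (1 - s ^ 2) * x := by
  constructor
  · linear_combination s * hc
  · linear_combination hc

/-- `N = (s + c)(1 + sc) = (1 − s²)²x/(1 − sx)²`. -/
theorem moebius_N (s x c : ℝ) (hsx : 1 - s * x ≠ 0) (hc : c * (1 - s * x) = x - s) :
    (s + c) * (1 + s * c) = (1 - s ^ 2) ^ 2 * x / (1 - s * x) ^ 2 := by
  rw [eq_div_iff (pow_ne_zero 2 hsx)]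
  linear_combination (s * (c * (1 - s * x) - (x - s)) + (1 - s ^ 2) + s * (1 - s ^ 2) * x) * hc

/-- `R² = 1 + s² + 2sc = (1 − s²)(1 + sx)/(1 − sx)`. -/
theorem moebius_radialSq (s x c : ℝ) (hsx : 1 - s * x ≠ 0) (hc : c * (1 - s * x) = x - s) :
    1 + s ^ 2 + 2 * s * c = (1 - s ^ 2) * (1 + s * x) / (1 - s * x) := by
  rw [eq_div_iff hsx]
  linear_combination 2 * s * hc

/-- `σ² = 1 − c² = (1 − s²)(1 − x²)/(1 − sx)²`. -/
theorem moebius_sinSq (s x c : ℝ) (hsx : 1 - s * x ≠ 0) (hc : c * (1 - s * x) = x - s) :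
    1 - c ^ 2 = (1 - s ^ 2) * (1 - x ^ 2) / (1 - s * x) ^ 2 := by
  rw [eq_div_iff (pow_ne_zero 2 hsx)]
  linear_combination (-(c * (1 - s * x) + (x - s))) * hc

/-- `R⁴ − 3sN = (1 − s²)²(1 − sx + s²x²)/(1 − sx)²`. -/
theorem moebius_fourth_sub (s x c : ℝ) (hsx : 1 - s * x ≠ 0) (hc : c * (1 - s * x) = x - s) :
    (1 + s ^ 2 + 2 * s * c) ^ 2 - 3 * s * ((s + c) * (1 + s * c))
      = (1 - s ^ 2) ^ 2 * (1 - s * x + s ^ 2 * x ^ 2) / (1 - s * x) ^ 2 := by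
  rw [eq_div_iff (pow_ne_zero 2 hsx)]
  linear_combination
    (s ^ 2 * (c * (1 - s * x) - (x - s)) + s * (1 - s ^ 2) * (1 + s * x)) * hc

/-- (M1) `f₂² = N²/R⁶ = (1 − s²)x²/((1 − sx)(1 + sx)³)`. -/
theorem moebius_normSecond_sq (s x c : ℝ) (hs : 1 - s ^ 2 ≠ 0) (hsx : 1 - s * x ≠ 0)
    (hsx' : 1 + s * x ≠ 0) (hc : c * (1 - s * x) = x - s) :
    ((s + c) * (1 + s * c)) ^ 2 / (1 + s ^ 2 + 2 * s * c) ^ 3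
      = (1 - s ^ 2) * x ^ 2 / ((1 - s * x) * (1 + s * x) ^ 3) := by
  rw [moebius_N s x c hsx hc, moebius_radialSq s x c hsx hc]
  field_simp

/-- (M2) `f₃² = σ²(R⁴ − 3sN)²/R¹⁰ = (1 − x²)(1 − sx + s²x²)²/((1 − sx)(1 + sx)⁵)`. -/
theorem moebius_normThird_sq (s x c : ℝ) (hs : 1 - s ^ 2 ≠ 0) (hsx : 1 - s * x ≠ 0)
    (hsx' : 1 + s * x ≠ 0) (hc : c * (1 - s * x) = x - s) :
    (1 - c ^ 2) * ((1 + s ^ 2 + 2 * s * c) ^ 2 - 3 * s * ((s + c) * (1 + s * c))) ^ 2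
        / (1 + s ^ 2 + 2 * s * c) ^ 5
      = (1 - x ^ 2) * (1 - s * x + s ^ 2 * x ^ 2) ^ 2 / ((1 - s * x) * (1 + s * x) ^ 5) := by
  rw [moebius_fourth_sub s x c hsx hc, moebius_sinSq s x c hsx hc, moebius_radialSq s x c hsx hc]
  field_simp

/-- (M3) `(σ/R)² = (1 − c²)/R² = (1 − x²)/((1 − sx)(1 + sx))`. -/
theorem moebius_sinRatio_sq (s x c : ℝ) (hs : 1 - s ^ 2 ≠ 0) (hsx : 1 - s * x ≠ 0)
    (hsx' : 1 + s * x ≠ 0) (hc : c * (1 - s * x) = x - s) :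
    (1 - c ^ 2) / (1 + s ^ 2 + 2 * s * c) = (1 - x ^ 2) / ((1 - s * x) * (1 + s * x)) := by
  rw [moebius_sinSq s x c hsx hc, moebius_radialSq s x c hsx hc]
  field_simp

/-! ## 3. Lemma (A): `4f₂² + 16f₃² ≥ 1` -/

/-- Homogeneous polynomial form of Lemma (A): for `p > 0`, `Y² ≤ U ≤ p²`,
`P_h(p,U,Y) = 4(U−Y²)(p+Y)²p² + 16(p²−U)(p²−pY+Y²)² − (p−Y)(p+Y)⁵ ≥ 0`.
It is affine in `U`, with endpoint values `P_h(p,p²,Y) = (p−Y)²(p+Y)³(3p+Y) ≥ 0` and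
`P_h(p,Y²,Y) = 3(p−Y)³(p+Y)(5p²−2pY+5Y²) ≥ 0` (`|Y| ≤ p`). -/
theorem profile_poly_hom_nonneg (p U Y : ℝ) (hp : 0 < p) (hYU : Y ^ 2 ≤ U) (hUp : U ≤ p ^ 2) :
    0 ≤ 4 * (U - Y ^ 2) * (p + Y) ^ 2 * p ^ 2 + 16 * (p ^ 2 - U) * (p ^ 2 - p * Y + Y ^ 2) ^ 2
        - (p - Y) * (p + Y) ^ 5 := by
  have hY : -p ≤ Y ∧ Y ≤ p := abs_le_of_sq_le_sq' (hYU.trans hUp) hp.le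
  have h1 : 0 ≤ p + Y := by linarith [hY.1]
  have h2 : 0 ≤ p - Y := by linarith [hY.2]
  have e1 : 0 ≤ (p - Y) ^ 2 * (p + Y) ^ 3 * (3 * p + Y) :=
    mul_nonneg (mul_nonneg (sq_nonneg _) (pow_nonneg h1 3)) (by linarith [hY.1])
  have i1 : 4 * (p ^ 2 - Y ^ 2) * (p + Y) ^ 2 * p ^ 2 - (p - Y) * (p + Y) ^ 5
      = (p - Y) ^ 2 * (p + Y) ^ 3 * (3 * p + Y) := by ring
  have e0 : 0 ≤ 3 * (p - Y) ^ 3 * (p + Y) * (5 * p ^ 2 - 2 * p * Y + 5 * Y ^ 2) := by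
    have : 0 ≤ 5 * p ^ 2 - 2 * p * Y + 5 * Y ^ 2 := by nlinarith [sq_nonneg (p - Y)]
    have h3 : 0 ≤ (p - Y) ^ 3 := pow_nonneg h2 3
    positivity
  have i0 : 16 * (p ^ 2 - Y ^ 2) * (p ^ 2 - p * Y + Y ^ 2) ^ 2 - (p - Y) * (p + Y) ^ 5
      = 3 * (p - Y) ^ 3 * (p + Y) * (5 * p ^ 2 - 2 * p * Y + 5 * Y ^ 2) := by ring
  -- the slope in `U`; an affine function is bounded below by its smaller endpoint value
  rcases le_total 0 (4 * (p + Y) ^ 2 * p ^ 2 - 16 * (p ^ 2 - p * Y + Y ^ 2) ^ 2) with hα | hα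
  · nlinarith [mul_nonneg (sub_nonneg.2 hYU) hα]
  · nlinarith [mul_nonneg (sub_nonneg.2 hUp) (neg_nonneg.2 hα)]

/-- Lemma (A) as in the note: for `y² ≤ u ≤ 1`,
`P(u,y) = 4(u−y²)(1+y)² + 16(1−u)(1−y+y²)² − (1−y)(1+y)⁵ ≥ 0` (`u = x²`, `y = sx`; over the
denominator `(1−y)(1+y)⁵` this is `4f₂² + 16f₃² − 1`), with the two endpoint factorisations. -/
theorem profile_poly_nonneg (u y : ℝ) (hyu : y ^ 2 ≤ u) (hu : u ≤ 1) :
    0 ≤ 4 * (u - y ^ 2) * (1 + y) ^ 2 + 16 * (1 - u) * (1 - y + y ^ 2) ^ 2 - (1 - y) * (1 + y) ^ 5 ∧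
    4 * (1 - y ^ 2) * (1 + y) ^ 2 - (1 - y) * (1 + y) ^ 5 = (1 - y) ^ 2 * (1 + y) ^ 3 * (3 + y) ∧
    16 * (1 - y ^ 2) * (1 - y + y ^ 2) ^ 2 - (1 - y) * (1 + y) ^ 5
      = 3 * (1 - y) ^ 3 * (1 + y) * (5 * y ^ 2 - 2 * y + 5) := by
  have h := profile_poly_hom_nonneg 1 u y one_pos hyu (by simpa using hu)
  exact ⟨by nlinarith [h], by ring, by ring⟩

/-- Lemma (A), DIRECT FORM in `c = cos θ`: for `0 ≤ s < 1` and `−1 ≤ c ≤ 1`,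
`R¹⁰ ≤ 4N²R⁴ + 16σ²(R⁴ − 3sN)²`, i.e. `4f₂² + 16f₃² ≥ 1` with `f₂ = |N|/R³ = |Φ″|/B`,
`f₃ = σ(R⁴−3sN)/R⁵ = Φ‴/B`.  Proof: `(1 − s²)·(rhs − lhs) = P_h(1+sc, (s+c)², s(s+c))`. -/
theorem four_normSecond_sq_add_sixteen_normThird_sq (s c : ℝ) (hs0 : 0 ≤ s) (hs1 : s < 1)
    (hc1 : -1 ≤ c) (hc2 : c ≤ 1) :
    (1 + s ^ 2 + 2 * s * c) ^ 5
      ≤ 4 * ((s + c) * (1 + s * c)) ^ 2 * (1 + s ^ 2 + 2 * s * c) ^ 2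
        + 16 * (1 - c ^ 2) * ((1 + s ^ 2 + 2 * s * c) ^ 2 - 3 * s * ((s + c) * (1 + s * c))) ^ 2 := by
  have hp := (radialSq_pos s c hs0 hs1 hc1).2
  have hs2 : 0 < 1 - s ^ 2 := by nlinarith
  have hYU : (s * (s + c)) ^ 2 ≤ (s + c) ^ 2 := by
    nlinarith [mul_nonneg hs2.le (sq_nonneg (s + c))]
  have hUp : (s + c) ^ 2 ≤ (1 + s * c) ^ 2 := by
    nlinarith [mul_nonneg hs2.le (show 0 ≤ 1 - c ^ 2 by nlinarith)]
  have key := profile_poly_hom_nonneg (1 + s * c) ((s + c) ^ 2) (s * (s + c)) hp hYU hUp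
  have id : (1 - s ^ 2) * (4 * ((s + c) * (1 + s * c)) ^ 2 * (1 + s ^ 2 + 2 * s * c) ^ 2
        + 16 * (1 - c ^ 2) * ((1 + s ^ 2 + 2 * s * c) ^ 2 - 3 * s * ((s + c) * (1 + s * c))) ^ 2
        - (1 + s ^ 2 + 2 * s * c) ^ 5)
      = 4 * ((s + c) ^ 2 - (s * (s + c)) ^ 2) * ((1 + s * c) + s * (s + c)) ^ 2 * (1 + s * c) ^ 2
        + 16 * ((1 + s * c) ^ 2 - (s + c) ^ 2)
            * ((1 + s * c) ^ 2 - (1 + s * c) * (s * (s + c)) + (s * (s + c)) ^ 2) ^ 2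
        - ((1 + s * c) - s * (s + c)) * ((1 + s * c) + s * (s + c)) ^ 5 := by
    ring
  by_contra h
  have h := not_le.mp h
  have : (1 - s ^ 2) * (4 * ((s + c) * (1 + s * c)) ^ 2 * (1 + s ^ 2 + 2 * s * c) ^ 2
        + 16 * (1 - c ^ 2) * ((1 + s ^ 2 + 2 * s * c) ^ 2 - 3 * s * ((s + c) * (1 + s * c))) ^ 2
        - (1 + s ^ 2 + 2 * s * c) ^ 5) < 0 := mul_neg_of_pos_of_neg hs2 (by linarith)
  linarith [key]

/-- The same about the normalised profiles themselves: `1 ≤ 4·(N²/R⁶) + 16·(σ²(R⁴−3sN)²/R¹⁰)`. -/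
theorem four_normSecond_sq_add_sixteen_normThird_sq_div (s c : ℝ) (hs0 : 0 ≤ s) (hs1 : s < 1)
    (hc1 : -1 ≤ c) (hc2 : c ≤ 1) :
    1 ≤ 4 * (((s + c) * (1 + s * c)) ^ 2 / (1 + s ^ 2 + 2 * s * c) ^ 3)
      + 16 * ((1 - c ^ 2) * ((1 + s ^ 2 + 2 * s * c) ^ 2 - 3 * s * ((s + c) * (1 + s * c))) ^ 2
          / (1 + s ^ 2 + 2 * s * c) ^ 5) := by
  have hR := (radialSq_pos s c hs0 hs1 hc1).1
  have h := four_normSecond_sq_add_sixteen_normThird_sq s c hs0 hs1 hc1 hc2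
  have hR3 : 0 < (1 + s ^ 2 + 2 * s * c) ^ 3 := by positivity
  have hR5 : 0 < (1 + s ^ 2 + 2 * s * c) ^ 5 := by positivity
  rw [mul_div_assoc', mul_div_assoc', div_add_div _ _ hR3.ne' hR5.ne', le_div_iff₀ (by positivity)]
  nlinarith [h, hR3, hR5]

/-- Corollary (A′) with `κ = 0.33`: if `4a² + 16b² ≥ 1` and `0 ≤ a < 33/100` then
`b² > m(κ)² = (1 − 4κ²)/16 = 1411/40000` and, for `b ≥ 0`, `b > 0.18781`
(`m(κ) = 0.187816…`); the threshold of Proposition 4(c) is `8m(κ)²/κ³ ≤ 7.86`. -/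
theorem normThird_lower_of_normSecond_lt (a b : ℝ) (h : 1 ≤ 4 * a ^ 2 + 16 * b ^ 2)
    (ha0 : 0 ≤ a) (ha : a < 33 / 100) (hb : 0 ≤ b) :
    (1411 : ℝ) / 40000 < b ^ 2 ∧ (18781 : ℝ) / 100000 < b ∧
    (8 : ℝ) * (1411 / 40000) / (33 / 100) ^ 3 ≤ 786 / 100 := by
  have ha2 : a ^ 2 < (33 / 100) ^ 2 := by nlinarith
  have hb2 : (1411 : ℝ) / 40000 < b ^ 2 := by nlinarith
  refine ⟨hb2, by nlinarith [hb2], by norm_num⟩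

/-! ## 4. Lemma (B): `(σ/R)² + 4f₂² ≥ 1` -/

/-- Lemma (B): in the Möbius variables `(1−x²)(1+y)² + 4(x²−y²) − (1−y)(1+y)³ = (x²−y²)(1−y)(3+y)`,
and directly `σ²R⁴ + 4N² − R⁶ = (s + c)²(1 − s²)(3 + 4sc + s²)`. -/
theorem sinRatio_sq_add_four_normSecond_sq_eq (s c x y : ℝ) :
    (1 - x ^ 2) * (1 + y) ^ 2 + 4 * (x ^ 2 - y ^ 2) - (1 - y) * (1 + y) ^ 3
      = (x ^ 2 - y ^ 2) * (1 - y) * (3 + y) ∧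
    (1 - c ^ 2) * (1 + s ^ 2 + 2 * s * c) ^ 2 + 4 * ((s + c) * (1 + s * c)) ^ 2
        - (1 + s ^ 2 + 2 * s * c) ^ 3
      = (s + c) ^ 2 * (1 - s ^ 2) * (3 + 4 * s * c + s ^ 2) := by
  constructor <;> ring

/-- hence `R⁶ ≤ σ²R⁴ + 4N²` for `0 ≤ s ≤ 1`, `c ≥ −1` (`3 + 4sc + s² ≥ (1−s)(3−s) ≥ 0`), i.e.
`(σ/R)² + 4f₂² ≥ 1`, with equality for `s < 1` exactly at the inflexion point `c = −s`. -/
theorem sinRatio_sq_add_four_normSecond_sq (s c : ℝ) (hs0 : 0 ≤ s) (hs1 : s ≤ 1) (hc1 : -1 ≤ c) :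
    (1 + s ^ 2 + 2 * s * c) ^ 3
      ≤ (1 - c ^ 2) * (1 + s ^ 2 + 2 * s * c) ^ 2 + 4 * ((s + c) * (1 + s * c)) ^ 2 := by
  have h3 : 0 ≤ 3 + 4 * s * c + s ^ 2 := by
    nlinarith [mul_nonneg hs0 (show 0 ≤ c + 1 by linarith)]
  have h : 0 ≤ (s + c) ^ 2 * (1 - s ^ 2) * (3 + 4 * s * c + s ^ 2) :=
    mul_nonneg (mul_nonneg (sq_nonneg _) (by nlinarith)) h3
  rw [← (sinRatio_sq_add_four_normSecond_sq_eq s c 0 0).2] at h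
  linarith

/-- Division form: `1 ≤ σ²/R² + 4N²/R⁶` for `0 ≤ s < 1`, `−1 ≤ c`. -/
theorem sinRatio_sq_add_four_normSecond_sq_div (s c : ℝ) (hs0 : 0 ≤ s) (hs1 : s < 1)
    (hc1 : -1 ≤ c) :
    1 ≤ (1 - c ^ 2) / (1 + s ^ 2 + 2 * s * c)
      + 4 * (((s + c) * (1 + s * c)) ^ 2 / (1 + s ^ 2 + 2 * s * c) ^ 3) := by
  have hR := (radialSq_pos s c hs0 hs1 hc1).1
  have h := sinRatio_sq_add_four_normSecond_sq s c hs0 hs1.le hc1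
  have hR3 : 0 < (1 + s ^ 2 + 2 * s * c) ^ 3 := by positivity
  rw [mul_div_assoc', div_add_div _ _ hR.ne' hR3.ne', le_div_iff₀ (by positivity)]
  nlinarith [h, hR, hR3]

/-- Corollary (B′): if `r² + 4a² ≥ 1`, `0 ≤ r < 3/4`, `a ≥ 0` then `64a² > 7`, i.e. `a > √7/8 = κ₁`
(used with `r = σ/R`, `a = f₂`); and `32κ₁ = 4√7 < 10.59`. -/
theorem normSecond_lower_of_sinRatio_lt (r a : ℝ) (h : 1 ≤ r ^ 2 + 4 * a ^ 2) (hr0 : 0 ≤ r)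
    (hr : r < 3 / 4) (ha : 0 ≤ a) :
    7 < 64 * a ^ 2 ∧ Real.sqrt 7 / 8 < a ∧ 4 * Real.sqrt 7 < (1059 : ℝ) / 100 := by
  have h1 : 7 < 64 * a ^ 2 := by nlinarith
  have h7 : Real.sqrt 7 < 2647 / 1000 := (Real.sqrt_lt' (by norm_num)).2 (by norm_num)
  refine ⟨h1, ?_, by linarith⟩
  rw [div_lt_iff₀ (by norm_num : (0:ℝ) < 8)]
  exact (Real.sqrt_lt' (by nlinarith)).2 (by nlinarith)

/-! ## 5. Bookkeeping of the constant `12` (§5 of the note)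

With `b = B^{1/3}` (`b² > 12 ⟺ B > 12^{3/2}`):  case `|m| < B/2`: `t² ≤ 128/(π²κ₁)·B⁻¹` with
`128/(π²κ₁) = 1024/(π²√7) < 39.22`, and `K/b³ ≤ 12/b²` for `K < 39.22`;  case `|m| ≥ B/2`
(`κ = 0.33`, `w := m(κ)^{1/3}`, `16w⁶ = 1 − 4κ² = 0.5644`): `2πt ≤ 12/(wb) + 8/b³ ⟹ t² ≤ 12/b²`. -/

/-- Case `|m| < B/2`: `1024/(π²√7) < 39.22`, and `t² ≤ K/b³` with `K ≤ 1024/(π²√7)`, `b² > 12`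
gives `t² ≤ 12/b²`. -/
theorem const_case_small_m (K b t : ℝ) (hK : K ≤ 1024 / (π ^ 2 * Real.sqrt 7)) (hb : 12 < b ^ 2)
    (hb0 : 0 < b) (ht : t ^ 2 ≤ K / b ^ 3) :
    (1024 : ℝ) / (π ^ 2 * Real.sqrt 7) < 3922 / 100 ∧ t ^ 2 ≤ 12 / b ^ 2 := by
  have hpi : (3.141592 : ℝ) < π := Real.pi_gt_d6
  have h7 : (2.6457 : ℝ) < Real.sqrt 7 := (Real.lt_sqrt (by norm_num)).2 (by norm_num)
  have hpi2 : (9.8696 : ℝ) < π ^ 2 := by nlinarith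
  have hden : (26.112 : ℝ) < π ^ 2 * Real.sqrt 7 := by
    nlinarith [mul_pos (sub_pos.2 hpi2) (sub_pos.2 h7)]
  have hc : (1024 : ℝ) / (π ^ 2 * Real.sqrt 7) < 3922 / 100 := by
    rw [div_lt_iff₀ (by positivity)]; nlinarith
  refine ⟨hc, ?_⟩
  have hb3 : 0 < b ^ 3 := by positivity
  have hb1 : 327 / 100 < b := by nlinarith
  calc t ^ 2 ≤ K / b ^ 3 := ht
    _ ≤ 12 / b ^ 2 := by
        rw [div_le_div_iff₀ hb3 (by positivity)]
        nlinarith [mul_pos hb0 (show (0:ℝ) < 12 * b - 3922 / 100 by linarith)]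

/-- Case `|m| ≥ B/2` (`κ = 0.33`, `16w⁶ = 1 − 4κ²`): `2πt ≤ 12/(wb) + 8/b³`, `b² > 12`, `t ≥ 0`
give `t² ≤ 12/b²` (numerically `t·b ≤ 3.443`, `3.443² = 11.854 ≤ 12`). -/
theorem const_case_large_m (w b t : ℝ) (hw0 : 0 < w) (hw : 16 * w ^ 6 = 1411 / 2500)
    (hb : 12 < b ^ 2) (hb0 : 0 < b) (ht0 : 0 ≤ t)
    (ht : 2 * π * t ≤ 12 / (w * b) + 8 / b ^ 3) : t ^ 2 ≤ 12 / b ^ 2 := by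
  have hpi : (3.141592 : ℝ) < π := Real.pi_gt_d6
  -- `w > 0.57267` since `16·0.57267⁶ < 0.5644`
  have hw1 : (57267 : ℝ) / 100000 < w := by
    by_contra hcon
    have hcon := not_lt.mp hcon
    have h6 : w ^ 6 ≤ ((57267 : ℝ) / 100000) ^ 6 := pow_le_pow_left₀ hw0.le hcon 6
    norm_num at h6
    linarith
  have hb1 : (3464 : ℝ) / 1000 < b := by nlinarith
  have hwb : 0 < w * b := mul_pos hw0 hb0
  -- `12/(wb) + 8/b³ ≤ 21.627/b`
  have h1 : 12 / (w * b) ≤ (2096 / 100) / b := by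
    rw [div_le_div_iff₀ hwb hb0]
    nlinarith [mul_pos (show (0:ℝ) < 2096 / 100 * w - 12 by linarith) hb0]
  have h2 : 8 / b ^ 3 ≤ (667 / 1000) / b := by
    rw [div_le_div_iff₀ (by positivity) hb0]
    nlinarith [mul_pos hb0 (show (0:ℝ) < 667 / 1000 * b ^ 2 - 8 by linarith)]
  have h3 : 2 * π * t ≤ (21627 / 1000) / b := by
    have := add_le_add h1 h2
    rw [← add_div] at this
    linarith
  -- hence `t·b ≤ 21.627/(2π) < 3.443`
  have h5 : 2 * π * t * b ≤ 21627 / 1000 := by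
    have := mul_le_mul_of_nonneg_right h3 hb0.le
    rwa [div_mul_cancel₀ _ hb0.ne'] at this
  have h4 : t * b ≤ 3443 / 1000 := by
    nlinarith [mul_nonneg (sub_pos.2 hpi).le (mul_nonneg ht0 hb0.le)]
  rw [le_div_iff₀ (by positivity)]
  have h6 : (t * b) ^ 2 ≤ (3443 / 1000 : ℝ) ^ 2 := pow_le_pow_left₀ (mul_nonneg ht0 hb0.le) h4 2
  nlinarith [h6]

end Summit.AtomisticToContinuum.BoseEinsteinCondensation.Theorems

end
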